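import Mathlib
import Summits.Ventures.PercRepro.PuncturedLYMSplit

/-!
# PercRepro — (SP) BY POINT SPLITTING: THE PUNCTURE OF A CO-HYPERPLANE FAMILY HAS AT MOST `C(n−1, j−1)` MEMBERS
(p10, gen 36)

A CO-HYPERPLANE FAMILY at level `j` on the ground set `S`: a family `𝒞` of subsets of `S` whose members of size `≤ j`
are nonempty and pairwise have unions of size `≥ j + 2` (the complements of the nontrivial hyperplanes of a paving matroid
of rank `#S − j`; members of size `> j` are irrelevant).  Its PUNCTURE `punct S j 𝒞` = the `j`-subsets of `S` containing
a member (the co-bases are the other `j`-subsets).  THEOREM (`card_punct_le`): **`#punct ≤ C(n − 1, j − 1)`** — in the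
matroid dictionary, a paving matroid of rank `r` on `n` points has at least `C(n − 1, r − 1)` bases, with equality at a
coloop.  Proof by POINT SPLITTING: the members of the puncture avoiding `x` form the puncture of `𝒞 ∖ x` on `S ∖ x` at
level `j`, those containing `x` (minus `x`) the puncture of `{C ∖ x}` on `S ∖ x` at level `j − 1`; both are co-hyperplane
families when no member is the singleton `{x}` (a singleton member is alone among the members of size `≤ j`: then the
puncture is the star of its point, of size exactly `C(n − 1, j − 1)`); induction on `#S` and Pascal's rule.
CONSEQUENCE (`root_excess_le`): in the uniform (SP)-instance of any co-hyperplane family, EVERY point `x` has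
`t(x) ≤ β·#P₀(x)` — the cross mass `κ = t(x)/#P₀(x)` of the split at `x` never exceeds the demand `β` of a column — so
at the root the split is valid at every point with nonnegative excess (`hasFlow_of_children_root`).
-/

namespace PercRepro.PuncturedLYM.Split

open Finset

variable {α : Type} [DecidableEq α]

/-- A co-hyperplane family at level `j` on `S`: the members of size `≤ j` are nonempty subsets of `S`, pairwise with
unions of size `≥ j + 2`. -/
def IsCoHypFamily (S : Finset α) (j : ℕ) (𝒞 : Finset (Finset α)) : Prop :=
  (∀ C ∈ 𝒞, C.card ≤ j → C ⊆ S ∧ C.Nonempty) ∧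
    ∀ C ∈ 𝒞, ∀ C' ∈ 𝒞, C.card ≤ j → C'.card ≤ j → C ≠ C' → j + 2 ≤ (C ∪ C').card

/-- The puncture: the `j`-subsets of `S` containing a member of `𝒞`. -/
def punct (S : Finset α) (j : ℕ) (𝒞 : Finset (Finset α)) : Finset (Finset α) :=
  (S.powersetCard j).filter (fun X => ∃ C ∈ 𝒞, C ⊆ X)

/-- The rows: the `j`-subsets of `S` containing no member. -/
def rowsOf (S : Finset α) (j : ℕ) (𝒞 : Finset (Finset α)) : Finset (Finset α) :=
  (S.powersetCard j).filter (fun X => ∀ C ∈ 𝒞, ¬ C ⊆ X)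

/-- Membership in the puncture. -/
theorem mem_punct {S X : Finset α} {j : ℕ} {𝒞 : Finset (Finset α)} :
    X ∈ punct S j 𝒞 ↔ (X ⊆ S ∧ X.card = j) ∧ ∃ C ∈ 𝒞, C ⊆ X := by
  simp [punct, mem_powersetCard]

/-- Membership in the rows. -/
theorem mem_rowsOf {S X : Finset α} {j : ℕ} {𝒞 : Finset (Finset α)} :
    X ∈ rowsOf S j 𝒞 ↔ (X ⊆ S ∧ X.card = j) ∧ ∀ C ∈ 𝒞, ¬ C ⊆ X := by
  simp [rowsOf, mem_powersetCard]

/-- Rows and puncture partition the level. -/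
theorem card_rowsOf_add_card_punct (S : Finset α) (j : ℕ) (𝒞 : Finset (Finset α)) :
    (rowsOf S j 𝒞).card + (punct S j 𝒞).card = (S.powersetCard j).card := by
  have h := card_filter_add_card_filter_not (s := S.powersetCard j) (fun X => ∃ C ∈ 𝒞, C ⊆ X)
  have hrows : rowsOf S j 𝒞 = (S.powersetCard j).filter (fun X => ¬ ∃ C ∈ 𝒞, C ⊆ X) := by
    unfold rowsOf
    congr 1
    ext X
    simp only [not_exists, not_and]
  rw [hrows, add_comm]
  exact h

/-- The members of `𝒞` avoiding `x`: a co-hyperplane family on `S ∖ x` at the same level. -/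
theorem isCoHypFamily_free {S : Finset α} {j : ℕ} {𝒞 : Finset (Finset α)} (h : IsCoHypFamily S j 𝒞) (x : α) :
    IsCoHypFamily (S.erase x) j (𝒞.filter (fun C => x ∉ C)) := by
  refine ⟨?_, ?_⟩
  · intro C hC hCj
    rw [mem_filter] at hC
    obtain ⟨hCS, hCne⟩ := h.1 C hC.1 hCj
    exact ⟨subset_erase.2 ⟨hCS, hC.2⟩, hCne⟩
  · intro C hC C' hC' hCj hC'j hne
    rw [mem_filter] at hC hC'
    exact h.2 C hC.1 C' hC'.1 hCj hC'j hne

/-- The members of `𝒞` with `x` removed: a co-hyperplane family on `S ∖ x` at level `j − 1`, provided `{x} ∉ 𝒞` and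
`0 < j`. -/
theorem isCoHypFamily_link {S : Finset α} {j : ℕ} {𝒞 : Finset (Finset α)} (h : IsCoHypFamily S j 𝒞) (hj : 0 < j)
    {x : α} (hx : {x} ∉ 𝒞) :
    IsCoHypFamily (S.erase x) (j - 1) (𝒞.image (fun C => C.erase x)) := by
  refine ⟨?_, ?_⟩
  · intro C' hC' hC'j
    obtain ⟨C, hC, rfl⟩ := mem_image.1 hC'
    have hCj : C.card ≤ j := by
      have := pred_card_le_card_erase (s := C) (a := x); omega
    obtain ⟨hCS, hCne⟩ := h.1 C hC hCj
    refine ⟨erase_subset_erase x hCS, ?_⟩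
    rw [nonempty_iff_ne_empty]
    intro hempty
    have hsub : C ⊆ {x} := by
      intro c hc
      by_contra hcx
      have : c ∈ C.erase x := mem_erase.2 ⟨fun h' => hcx (h' ▸ mem_singleton_self x), hc⟩
      rw [hempty] at this; exact notMem_empty c this
    have hCeq : C = {x} := by
      apply eq_of_subset_of_card_le hsub
      rw [card_singleton]; exact card_pos.2 hCne
    exact hx (hCeq ▸ hC)
  · intro C₁' hC₁' C₂' hC₂' hC₁j hC₂j hne
    obtain ⟨C₁, hC₁, rfl⟩ := mem_image.1 hC₁'
    obtain ⟨C₂, hC₂, rfl⟩ := mem_image.1 hC₂'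
    have hC₁j' : C₁.card ≤ j := by have := pred_card_le_card_erase (s := C₁) (a := x); omega
    have hC₂j' : C₂.card ≤ j := by have := pred_card_le_card_erase (s := C₂) (a := x); omega
    have hne' : C₁ ≠ C₂ := fun h' => hne (h' ▸ rfl)
    have hU := h.2 C₁ hC₁ C₂ hC₂ hC₁j' hC₂j' hne'
    have hU' : (C₁.erase x ∪ C₂.erase x) = (C₁ ∪ C₂).erase x := by
      ext c; simp only [mem_union, mem_erase]; tauto
    rw [hU']
    have h2 := pred_card_le_card_erase (s := C₁ ∪ C₂) (a := x)
    omega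

/-- The members of the puncture avoiding `x` form the puncture of `𝒞 ∖ x` on `S ∖ x`. -/
theorem punct_filter_notMem (S : Finset α) (j : ℕ) (𝒞 : Finset (Finset α)) (x : α) :
    (punct S j 𝒞).filter (fun X => x ∉ X) = punct (S.erase x) j (𝒞.filter (fun C => x ∉ C)) := by
  ext X
  simp only [mem_filter, mem_punct, subset_erase]
  constructor
  · rintro ⟨⟨⟨hXS, hXc⟩, C, hC, hCX⟩, hxX⟩
    exact ⟨⟨⟨hXS, hxX⟩, hXc⟩, C, ⟨hC, fun h => hxX (hCX h)⟩, hCX⟩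
  · rintro ⟨⟨⟨hXS, hxX⟩, hXc⟩, C, ⟨hC, _⟩, hCX⟩
    exact ⟨⟨⟨hXS, hXc⟩, C, hC, hCX⟩, hxX⟩

/-- The members of the puncture containing `x ∈ S`, with `x` removed, are the puncture of `{C ∖ x}` at level `j − 1`. -/
theorem card_punct_filter_mem {S : Finset α} {j : ℕ} (hj : 0 < j) (𝒞 : Finset (Finset α)) {x : α} (hx : x ∈ S) :
    ((punct S j 𝒞).filter (fun X => x ∈ X)).card
      = (punct (S.erase x) (j - 1) (𝒞.image (fun C => C.erase x))).card := by
  apply card_nbij' (fun X => X.erase x) (fun X' => insert x X')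
  · intro X hX
    simp only [coe_filter, Set.mem_setOf_eq, mem_punct] at hX
    obtain ⟨⟨⟨hXS, hXc⟩, C, hC, hCX⟩, hxX⟩ := hX
    simp only [mem_coe, mem_punct, subset_erase]
    exact ⟨⟨⟨(erase_subset x X).trans hXS, notMem_erase x X⟩, by rw [card_erase_of_mem hxX, hXc]⟩, C.erase x,
      mem_image_of_mem _ hC, (erase_subset x C).trans hCX, notMem_erase x C⟩
  · intro X' hX'
    simp only [mem_coe, mem_punct, subset_erase] at hX'
    obtain ⟨⟨⟨hX'S, hxX'⟩, hX'c⟩, C', hC', hC'X'⟩ := hX'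
    obtain ⟨C, hC, rfl⟩ := mem_image.1 hC'
    simp only [coe_filter, Set.mem_setOf_eq, mem_punct]
    refine ⟨⟨⟨insert_subset hx hX'S, by rw [card_insert_of_notMem hxX', hX'c]; omega⟩, C, hC, ?_⟩, mem_insert_self x X'⟩
    intro c hc
    by_cases hcx : c = x
    · subst hcx; exact mem_insert_self c X'
    · exact mem_insert_of_mem (hC'X' (mem_erase.2 ⟨hcx, hc⟩))
  · intro X hX
    simp only [coe_filter, Set.mem_setOf_eq] at hX
    exact insert_erase hX.2
  · intro X' hX'
    simp only [mem_coe, mem_punct, subset_erase] at hX'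
    exact erase_insert hX'.1.1.2

/-- A singleton member is the only member of size `≤ j` (`0 < j`): the puncture is the star of its point. -/
theorem punct_eq_of_singleton_mem {S : Finset α} {j : ℕ} {𝒞 : Finset (Finset α)} (h : IsCoHypFamily S j 𝒞)
    (hj : 0 < j) {y : α} (hy : {y} ∈ 𝒞) :
    punct S j 𝒞 = (S.powersetCard j).filter (fun X => y ∈ X) := by
  ext X
  simp only [punct, mem_filter, mem_powersetCard]
  constructor
  · rintro ⟨hX, C, hC, hCX⟩
    refine ⟨hX, ?_⟩
    by_cases hCy : C = {y}
    · subst hCy; exact hCX (mem_singleton_self y)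
    · exfalso
      by_cases hCj : C.card ≤ j
      · have := h.2 C hC {y} hy hCj (by rw [card_singleton]; exact hj) hCy
        have h2 : (C ∪ {y}).card ≤ C.card + 1 := by
          calc (C ∪ {y}).card ≤ C.card + ({y} : Finset α).card := card_union_le _ _
            _ = C.card + 1 := by rw [card_singleton]
        omega
      · have : C.card ≤ X.card := card_le_card hCX
        omega
  · rintro ⟨hX, hyX⟩
    exact ⟨hX, {y}, hy, singleton_subset_iff.2 hyX⟩

/-- The star of a point `y ∈ S` in the level `j ≥ 1` has `C(n − 1, j − 1)` members. -/
theorem card_powersetCard_filter_mem {S : Finset α} {j : ℕ} (hj : 0 < j) {y : α} (hy : y ∈ S) :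
    ((S.powersetCard j).filter (fun X => y ∈ X)).card = (S.card - 1).choose (j - 1) := by
  rw [← card_erase_of_mem hy, ← card_powersetCard]
  apply card_nbij' (fun X => X.erase y) (fun X' => insert y X')
  · intro X hX
    simp only [coe_filter, Set.mem_setOf_eq, mem_powersetCard] at hX
    simp only [mem_coe, mem_powersetCard]
    exact ⟨erase_subset_erase y hX.1.1, by rw [card_erase_of_mem hX.2, hX.1.2]⟩
  · intro X' hX'
    simp only [mem_coe, mem_powersetCard, subset_erase] at hX'
    simp only [coe_filter, Set.mem_setOf_eq, mem_powersetCard]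
    exact ⟨⟨insert_subset hy hX'.1.1, by rw [card_insert_of_notMem hX'.1.2, hX'.2]; omega⟩, mem_insert_self y X'⟩
  · intro X hX
    simp only [coe_filter, Set.mem_setOf_eq] at hX
    exact insert_erase hX.2
  · intro X' hX'
    simp only [mem_coe, mem_powersetCard, subset_erase] at hX'
    exact erase_insert hX'.1.2

/-- Without a singleton member the level `1` is not punctured. -/
theorem punct_one_eq_empty {S : Finset α} {𝒞 : Finset (Finset α)} (h : IsCoHypFamily S 1 𝒞)
    (hsing : ∀ y, {y} ∉ 𝒞) : punct S 1 𝒞 = ∅ := by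
  ext X
  simp only [mem_punct, notMem_empty, iff_false, not_and, not_exists]
  rintro ⟨_, hXc⟩ C hC hCX
  have hC1 : C.card ≤ 1 := (card_le_card hCX).trans hXc.le
  obtain ⟨_, hCne⟩ := h.1 C hC hC1
  obtain ⟨c, hc⟩ := hCne
  have hCeq : C = {c} := by
    apply eq_of_subset_of_card_le
    · intro c' hc'
      rw [mem_singleton]
      exact card_le_one.1 hC1 c' hc' c hc
    · rw [card_singleton]; exact card_pos.2 ⟨c, hc⟩
  exact hsing c (hCeq ▸ hC)

/-- **THE COUNTING THEOREM.** The puncture of a co-hyperplane family at level `j` on `n` points has at most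
`C(n − 1, j − 1)` members — a paving matroid of rank `r` on `n` points has at least `C(n − 1, r − 1)` bases. -/
theorem card_punct_le (n : ℕ) : ∀ (S : Finset α) (j : ℕ) (𝒞 : Finset (Finset α)), S.card = n →
    IsCoHypFamily S j 𝒞 → (punct S j 𝒞).card ≤ (n - 1).choose (j - 1) := by
  induction n using Nat.strong_induction_on with
  | _ n ih =>
  intro S j 𝒞 hn h
  -- `j = 0`: no member fits in `∅`
  rcases Nat.eq_zero_or_pos j with hj0 | hj
  · subst hj0
    have : punct S 0 𝒞 = ∅ := by
      ext X
      simp only [mem_punct, notMem_empty, iff_false, not_and, not_exists]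
      rintro ⟨_, hXc⟩ C hC hCX
      have hC0 : C.card = 0 := by
        have := card_le_card hCX; omega
      exact (h.1 C hC (by omega)).2.ne_empty (card_eq_zero.1 hC0)
    rw [this]; simp
  -- a singleton member: the puncture is its star
  by_cases hsing : ∃ y, {y} ∈ 𝒞
  · obtain ⟨y, hy⟩ := hsing
    have hyS : y ∈ S := (h.1 {y} hy (by rw [card_singleton]; exact hj)).1 (mem_singleton_self y)
    rw [punct_eq_of_singleton_mem h hj hy, card_powersetCard_filter_mem hj hyS, hn]
  simp only [not_exists] at hsing
  -- `j = 1` without a singleton member: empty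
  rcases Nat.lt_or_ge j 2 with hj1 | hj2
  · have hj1' : j = 1 := by omega
    subst hj1'
    rw [punct_one_eq_empty h hsing]; simp
  -- `n < 2 < j + 1`: no `j`-subset at all
  rcases Nat.lt_or_ge n 2 with hn2 | hn2
  · apply le_trans (card_le_card (filter_subset _ _)) _
    rw [card_powersetCard, hn, Nat.choose_eq_zero_of_lt (by omega)]
    exact Nat.zero_le _
  -- the split at a point `x ∈ S`
  obtain ⟨x, hx⟩ : S.Nonempty := by rw [← card_pos, hn]; omega
  have hsplit := card_filter_add_card_filter_not (s := punct S j 𝒞) (fun X => x ∈ X)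
  have hn1 : (S.erase x).card = n - 1 := by rw [card_erase_of_mem hx, hn]
  have h0 := ih (n - 1) (by omega) (S.erase x) j (𝒞.filter (fun C => x ∉ C)) hn1 (isCoHypFamily_free h x)
  have h1 := ih (n - 1) (by omega) (S.erase x) (j - 1) (𝒞.image (fun C => C.erase x)) hn1
    (isCoHypFamily_link h hj (hsing x))
  rw [← hsplit, card_punct_filter_mem hj 𝒞 hx]
  have hnot : (punct S j 𝒞).filter (fun X => ¬ x ∈ X) = (punct S j 𝒞).filter (fun X => x ∉ X) := rfl
  rw [hnot, punct_filter_notMem]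
  have hpascal : (n - 1).choose (j - 1) = (n - 2).choose (j - 2) + (n - 2).choose (j - 1) := by
    have := Nat.choose_succ_succ' (n - 2) (j - 2)
    rw [show n - 2 + 1 = n - 1 by omega, show j - 2 + 1 = j - 1 by omega] at this
    exact this
  rw [hpascal]
  have e1 : n - 1 - 1 = n - 2 := by omega
  have e2 : j - 1 - 1 = j - 2 := by omega
  rw [e1, e2] at h1
  rw [e1] at h0
  omega

/-- The rows are at least `C(n − 1, j)`: the complement of the puncture in `C(n, j)`. -/
theorem choose_le_card_rowsOf {S : Finset α} {j : ℕ} {𝒞 : Finset (Finset α)} (h : IsCoHypFamily S j 𝒞)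
    (hj : 0 < j) (hn : 1 ≤ S.card) : (S.card - 1).choose j ≤ (rowsOf S j 𝒞).card := by
  have h1 := card_rowsOf_add_card_punct S j 𝒞
  have h2 := card_punct_le S.card S j 𝒞 rfl h
  rw [card_powersetCard] at h1
  have hpascal : S.card.choose j = (S.card - 1).choose (j - 1) + (S.card - 1).choose j := by
    have := Nat.choose_succ_succ' (S.card - 1) (j - 1)
    rw [show S.card - 1 + 1 = S.card by omega, show j - 1 + 1 = j by omega] at this
    exact this
  omega

/-- The `x`-free rows (`x ∈ S`) are at most `C(n − 1, j)`. -/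
theorem card_rowsFree_rowsOf_le (S : Finset α) (j : ℕ) (𝒞 : Finset (Finset α)) {x : α} (hx : x ∈ S) :
    (rowsFree (rowsOf S j 𝒞) x).card ≤ (S.card - 1).choose j := by
  rw [← card_erase_of_mem hx, ← card_powersetCard]
  apply card_le_card
  intro X hX
  rw [mem_rowsFree, mem_rowsOf] at hX
  rw [mem_powersetCard]
  exact ⟨subset_erase.2 ⟨hX.1.1.1, hX.2⟩, hX.1.1.2⟩

/-- **THE ROOT STEP IS ALWAYS VALID.** In the uniform instance of a co-hyperplane family (row mass `ρ`, column
demand `β`, `ρ·#P = β·#Y`), every point `x ∈ S` has excess at most `β·#P₀(x)`: the cross mass `κ = t(x)/#P₀(x)` of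
the split at `x` never exceeds the demand `β` of a column.  (`#P₀·(#Y − #P) ≤ #Y₀·#P` from `#P ≥ C(n−1, j)`,
`#P₀ ≤ C(n−1, j)` and `#Y − #Y₀ = C(n−1, j)`.) -/
theorem root_excess_le {S : Finset α} {j : ℕ} {𝒞 : Finset (Finset α)} (h : IsCoHypFamily S j 𝒞) (hj : 0 < j)
    {ρ β : ℚ} (hβ : 0 ≤ β) (htot : ρ * (rowsOf S j 𝒞).card = β * (cols S j).card) {x : α}
    (hx : x ∈ S) :
    excess S j (rowsOf S j 𝒞) (fun _ => ρ) (fun _ => β) x ≤ β * (rowsFree (rowsOf S j 𝒞) x).card := by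
  have hn : 1 ≤ S.card := card_pos.2 ⟨x, hx⟩
  -- the counts
  set P := (rowsOf S j 𝒞).card with hP_def
  set P0 := (rowsFree (rowsOf S j 𝒞) x).card with hP0_def
  set L := (cols S j).card with hL_def
  set L0 := (cols (S.erase x) j).card with hL0_def
  have hL0 : L0 = (S.card - 1).choose (j + 1) := by rw [hL0_def, cols, card_powersetCard, card_erase_of_mem hx]
  have hL : L = (S.card - 1).choose j + L0 := by
    rw [hL_def, hL0, cols, card_powersetCard]
    have := Nat.choose_succ_succ' (S.card - 1) j
    rwa [show S.card - 1 + 1 = S.card by omega] at this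
  have hPge : (S.card - 1).choose j ≤ P := choose_le_card_rowsOf h hj hn
  have hP0le : P0 ≤ (S.card - 1).choose j := card_rowsFree_rowsOf_le S j 𝒞 hx
  have hkey : P0 * L ≤ (P0 + L0) * P := by
    rw [hL]
    calc P0 * ((S.card - 1).choose j + L0) = P0 * (S.card - 1).choose j + P0 * L0 := by ring
      _ ≤ P0 * P + P * L0 := by
          apply Nat.add_le_add
          · exact Nat.mul_le_mul_left _ hPge
          · exact Nat.mul_le_mul_right _ (hP0le.trans hPge)
      _ = (P0 + L0) * P := by ring
  -- the excess in terms of `P0`, `L0`: `t = ρ·P0 − β·L0`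
  have hsplitL : ((cols S j).filter (fun Y => x ∈ Y)).card + L0 = L := by
    have h1 := card_filter_add_card_filter_not (s := cols S j) (fun Y => x ∈ Y)
    have h2 : (cols S j).filter (fun Y => ¬ x ∈ Y) = cols (S.erase x) j := by
      ext Y; simp only [mem_filter, mem_cols, subset_erase]; tauto
    rw [h2] at h1; exact h1
  have hsplitP : ((rowsOf S j 𝒞).filter (fun X => x ∈ X)).card + P0 = P := by
    have h1 := card_filter_add_card_filter_not (s := rowsOf S j 𝒞) (fun X => x ∈ X)
    exact h1
  have hexc : excess S j (rowsOf S j 𝒞) (fun _ => ρ) (fun _ => β) x = ρ * P0 - β * L0 := by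
    unfold excess
    rw [sum_const, sum_const, nsmul_eq_mul, nsmul_eq_mul]
    have e1 : (((cols S j).filter (fun Y => x ∈ Y)).card : ℚ) = L - L0 := by
      rw [← hsplitL]; push_cast; ring
    have e2 : (((rowsOf S j 𝒞).filter (fun X => x ∈ X)).card : ℚ) = P - P0 := by
      rw [← hsplitP]; push_cast; ring
    rw [e1, e2]
    linear_combination -htot
  rw [hexc]
  -- `ρ·P0 ≤ β·(P0 + L0)`: multiply by `P` and use `ρ·P = β·L` and the key inequality
  rcases Nat.eq_zero_or_pos P with hP0z | hPpos
  · have hP0z' : P0 = 0 := by omega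
    rw [hP0z']; simp; exact mul_nonneg hβ (Nat.cast_nonneg _)
  have hPq : (0 : ℚ) < P := by exact_mod_cast hPpos
  have hkeyq : (P0 : ℚ) * L ≤ (P0 + L0) * P := by exact_mod_cast hkey
  have : ρ * P0 * P ≤ β * (P0 + L0) * P := by
    calc ρ * P0 * P = (ρ * P) * P0 := by ring
      _ = β * L * P0 := by rw [htot]
      _ = β * (P0 * L) := by ring
      _ ≤ β * ((P0 + L0) * P) := mul_le_mul_of_nonneg_left hkeyq hβ
      _ = β * (P0 + L0) * P := by ring
  have h3 : ρ * P0 ≤ β * (P0 + L0) := le_of_mul_le_mul_right this hPq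
  linarith

/-- **THE ROOT STEP.** At a point `x ∈ S` with nonnegative excess, the uniform cross mass `κ = t(x)/#P₀(x)` lies in
`[0, β]`, so the split of (SP) at `x` is valid: the rows of the `x`-free half keep a nonnegative mass `ρ − κ`
(`ρ·#P₀ ≥ β·#Y₀`) and every column of the `x`-half keeps a nonnegative demand; (SP) for the family then follows from
flows of the two halves by `hasFlow_glue`. -/
theorem root_kappa_bounds {S : Finset α} {j : ℕ} {𝒞 : Finset (Finset α)} (h : IsCoHypFamily S j 𝒞) (hj : 0 < j)
    {ρ β : ℚ} (hβ : 0 ≤ β) (htot : ρ * (rowsOf S j 𝒞).card = β * (cols S j).card) {x : α} (hx : x ∈ S)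
    (ht : 0 ≤ excess S j (rowsOf S j 𝒞) (fun _ => ρ) (fun _ => β) x)
    (hP0 : 0 < (rowsFree (rowsOf S j 𝒞) x).card) :
    0 ≤ excess S j (rowsOf S j 𝒞) (fun _ => ρ) (fun _ => β) x / (rowsFree (rowsOf S j 𝒞) x).card ∧
      excess S j (rowsOf S j 𝒞) (fun _ => ρ) (fun _ => β) x / (rowsFree (rowsOf S j 𝒞) x).card ≤ β := by
  have hP0q : (0 : ℚ) < (rowsFree (rowsOf S j 𝒞) x).card := by exact_mod_cast hP0
  refine ⟨div_nonneg ht hP0q.le, ?_⟩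
  rw [div_le_iff₀ hP0q]
  exact root_excess_le h hj hβ htot hx

end PercRepro.PuncturedLYM.Split
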